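import Mathlib
import Summits.Ventures.PercRepro2.Defs
import Summits.Ventures.PercRepro2.Harris
import Summits.Ventures.PercRepro2.Graph
import Summits.Ventures.PercRepro2.Events
import Summits.Ventures.PercRepro2.BHKAvoidWeighted
import Summits.Ventures.PercRepro2.PsiPendantLemmas
import Summits.Ventures.PercRepro2.PsiUniIsolated
import Summits.Ventures.PercRepro2.PsiPinInduction

/-!
# The Bernstein form of the one-edge cubic of the (Ψ)-slack and the frame (Ψ) ⟸ (BERN) (PercRepro2, p2)

Along one edge `f` the eight masses of the (Ψ)-slack `Σ_𝓤 = Ug·((q − aH)·oL + q·(oLH + oHH) − aH·oH)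
− oLU·q²` are affine in `w = p f` (`prob_eq_pin`), so `Σ_𝓤` is a cubic in `w` with the Bernstein form
`Σ(w) = (1 − w)³·Σ⁰ + (1 − w)²·w·T₁ + (1 − w)·w²·T₂ + w³·Σ¹`, where `Σ⁰, Σ¹` are the slacks with `f`
pinned closed / open and `T₁ = ∇Σ(M⁰)·M¹`, `T₂ = ∇Σ(M¹)·M⁰` (three times the two mixed Bernstein
coefficients).  If `T₁, T₂ ≥ 0` for SOME unpinned edge of every instance, the pin induction closes
without the one-edge min property of `PsiPinInduction.lean`: `0 ≤ Σ⁰`, `0 ≤ Σ¹` by induction and the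
four Bernstein terms are nonnegative.  Census (P2-G17-PSI.md §8.2, §9.3, two seats two codes):
`T₁, T₂ ≥ 0` on every one of ≈ 180,000 (instance, edge, up-set) pairs, every edge type — including the
pairs on which the min property fails.

* `bernstein_algebra` — the cubic identity in the sixteen masses;
* `bern_step_algebra` — nonnegativity from the four Bernstein coefficients;
* `psi_slack_eq_bernstein` — **the Bernstein form of the slack along one edge**;
* `psi_slack_nonneg_of_step` — the pin induction with the weakest step hypothesis
  (`0 ≤ Σ⁰ → 0 ≤ Σ¹ → 0 ≤ Σ` for some unpinned edge of every instance);
* `psi_slack_nonneg_of_bern` — **the frame (Ψ) ⟸ (BERN)**.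
-/

namespace Summit.Ventures.PercRepro2

section Algebra

variable {R : Type*} [CommRing R] [LinearOrder R] [IsStrictOrderedRing R]

omit [LinearOrder R] [IsStrictOrderedRing R] in
/-- The cubic form `Σ(M) = g·((q − a)·l + q·(x + y) − a·h) − z·q²` along the segment from `M⁰` to
`M¹`: its Bernstein form with `T₁ = ∇Σ(M⁰)·M¹` and `T₂ = ∇Σ(M¹)·M⁰`. -/
lemma bernstein_algebra (w q0 l0 h0 a0 x0 y0 g0 z0 q1 l1 h1 a1 x1 y1 g1 z1 : R) :
    (w * g1 + (1 - w) * g0) *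
        (((w * q1 + (1 - w) * q0) - (w * a1 + (1 - w) * a0)) * (w * l1 + (1 - w) * l0) +
          (w * q1 + (1 - w) * q0) * ((w * x1 + (1 - w) * x0) + (w * y1 + (1 - w) * y0)) -
          (w * a1 + (1 - w) * a0) * (w * h1 + (1 - w) * h0)) -
      (w * z1 + (1 - w) * z0) * (w * q1 + (1 - w) * q0) * (w * q1 + (1 - w) * q0) =
    (1 - w) ^ 3 * (g0 * ((q0 - a0) * l0 + q0 * (x0 + y0) - a0 * h0) - z0 * q0 * q0) +
      (1 - w) ^ 2 * w * (((q0 - a0) * l0 + q0 * (x0 + y0) - a0 * h0) * g1 +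
        (g0 * (l0 + x0 + y0) - 2 * z0 * q0) * q1 + g0 * (q0 - a0) * l1 - g0 * (l0 + h0) * a1 +
        g0 * q0 * (x1 + y1) - g0 * a0 * h1 - q0 * q0 * z1) +
      (1 - w) * w ^ 2 * (((q1 - a1) * l1 + q1 * (x1 + y1) - a1 * h1) * g0 +
        (g1 * (l1 + x1 + y1) - 2 * z1 * q1) * q0 + g1 * (q1 - a1) * l0 - g1 * (l1 + h1) * a0 +
        g1 * q1 * (x0 + y0) - g1 * a1 * h0 - q1 * q1 * z0) +
      w ^ 3 * (g1 * ((q1 - a1) * l1 + q1 * (x1 + y1) - a1 * h1) - z1 * q1 * q1) := by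
  ring

/-- A cubic with nonnegative Bernstein coefficients is nonnegative on `[0, 1]`. -/
lemma bern_step_algebra {w S0 S1 T1 T2 : R} (hw : 0 ≤ w) (hw1 : w ≤ 1) (h0 : 0 ≤ S0)
    (h1 : 0 ≤ S1) (hT1 : 0 ≤ T1) (hT2 : 0 ≤ T2) :
    0 ≤ (1 - w) ^ 3 * S0 + (1 - w) ^ 2 * w * T1 + (1 - w) * w ^ 2 * T2 + w ^ 3 * S1 := by
  have hv : 0 ≤ 1 - w := sub_nonneg.2 hw1
  have e1 : 0 ≤ (1 - w) ^ 3 * S0 := mul_nonneg (pow_nonneg hv 3) h0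
  have e2 : 0 ≤ (1 - w) ^ 2 * w * T1 := mul_nonneg (mul_nonneg (pow_nonneg hv 2) hw) hT1
  have e3 : 0 ≤ (1 - w) * w ^ 2 * T2 := mul_nonneg (mul_nonneg hv (pow_nonneg hw 2)) hT2
  have e4 : 0 ≤ w ^ 3 * S1 := mul_nonneg (pow_nonneg hw 3) h1
  linarith

end Algebra

section Bernstein

variable {V : Type*} {E : Type*} [Fintype E] [DecidableEq E]
  {R : Type*} [CommRing R] [LinearOrder R] [IsStrictOrderedRing R]

omit [LinearOrder R] [IsStrictOrderedRing R] in
/-- **The Bernstein form of the (Ψ)-slack along the edge `f`**: with `Σ⁰, Σ¹` the slacks with `f`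
pinned closed / open and `T₁ = ∇Σ(M⁰)·M¹`, `T₂ = ∇Σ(M¹)·M⁰` in the sixteen pinned masses,
`Σ(p) = (1 − w)³·Σ⁰ + (1 − w)²·w·T₁ + (1 − w)·w²·T₂ + w³·Σ¹`, `w = p f`. -/
lemma psi_slack_eq_bernstein (p : E → R) (ends : E → Sym2 V) (s t o u : V) (𝓤 : Set (Set V))
    (f : E) :
    (prob p (clusterInEvent ends s 𝓤 ∩ (connEvent ends s t)ᶜ) *
        ((prob p (connEvent ends s t)ᶜ - prob p (connEvent ends s u ∩ (connEvent ends s t)ᶜ)) *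
            prob p (clusterInEvent ends t {W : Set V | o ∈ W} ∩ (connEvent ends s t)ᶜ) +
          prob p (connEvent ends s t)ᶜ *
            (prob p (connEvent ends s u ∩ clusterInEvent ends t {W : Set V | o ∈ W} ∩
          (connEvent ends s t)ᶜ) +
              prob p (connEvent ends s u ∩ clusterInEvent ends s {W : Set V | o ∈ W} ∩
          (connEvent ends s t)ᶜ)) -
          prob p (connEvent ends s u ∩ (connEvent ends s t)ᶜ) *
            prob p (clusterInEvent ends s {W : Set V | o ∈ W} ∩ (connEvent ends s t)ᶜ)) -
      prob p (clusterInEvent ends s 𝓤 ∩ clusterInEvent ends t {W : Set V | o ∈ W} ∩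
          (connEvent ends s t)ᶜ) * prob p (connEvent ends s t)ᶜ * prob p (connEvent ends s t)ᶜ) =
      (1 - p f) ^ 3 * (prob (Function.update p f 0) (clusterInEvent ends s 𝓤 ∩ (connEvent ends s t)ᶜ) *
        ((prob (Function.update p f 0) (connEvent ends s t)ᶜ - prob (Function.update p f 0) (connEvent ends s u ∩ (connEvent ends s t)ᶜ)) *
            prob (Function.update p f 0) (clusterInEvent ends t {W : Set V | o ∈ W} ∩ (connEvent ends s t)ᶜ) +
          prob (Function.update p f 0) (connEvent ends s t)ᶜ *
            (prob (Function.update p f 0) (connEvent ends s u ∩ clusterInEvent ends t {W : Set V | o ∈ W} ∩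
          (connEvent ends s t)ᶜ) +
              prob (Function.update p f 0) (connEvent ends s u ∩ clusterInEvent ends s {W : Set V | o ∈ W} ∩
          (connEvent ends s t)ᶜ)) -
          prob (Function.update p f 0) (connEvent ends s u ∩ (connEvent ends s t)ᶜ) *
            prob (Function.update p f 0) (clusterInEvent ends s {W : Set V | o ∈ W} ∩ (connEvent ends s t)ᶜ)) -
      prob (Function.update p f 0) (clusterInEvent ends s 𝓤 ∩ clusterInEvent ends t {W : Set V | o ∈ W} ∩
          (connEvent ends s t)ᶜ) * prob (Function.update p f 0) (connEvent ends s t)ᶜ * prob (Function.update p f 0) (connEvent ends s t)ᶜ) +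
      (1 - p f) ^ 2 * p f * (((prob (Function.update p f 0) (connEvent ends s t)ᶜ - prob (Function.update p f 0) (connEvent ends s u ∩ (connEvent ends s t)ᶜ)) * prob (Function.update p f 0) (clusterInEvent ends t {W : Set V | o ∈ W} ∩ (connEvent ends s t)ᶜ) +
          prob (Function.update p f 0) (connEvent ends s t)ᶜ * (prob (Function.update p f 0) (connEvent ends s u ∩ clusterInEvent ends t {W : Set V | o ∈ W} ∩
          (connEvent ends s t)ᶜ) + prob (Function.update p f 0) (connEvent ends s u ∩ clusterInEvent ends s {W : Set V | o ∈ W} ∩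
          (connEvent ends s t)ᶜ)) -
          prob (Function.update p f 0) (connEvent ends s u ∩ (connEvent ends s t)ᶜ) * prob (Function.update p f 0) (clusterInEvent ends s {W : Set V | o ∈ W} ∩ (connEvent ends s t)ᶜ)) * prob (Function.update p f 1) (clusterInEvent ends s 𝓤 ∩ (connEvent ends s t)ᶜ) +
        (prob (Function.update p f 0) (clusterInEvent ends s 𝓤 ∩ (connEvent ends s t)ᶜ) * (prob (Function.update p f 0) (clusterInEvent ends t {W : Set V | o ∈ W} ∩ (connEvent ends s t)ᶜ) + prob (Function.update p f 0) (connEvent ends s u ∩ clusterInEvent ends t {W : Set V | o ∈ W} ∩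
          (connEvent ends s t)ᶜ) + prob (Function.update p f 0) (connEvent ends s u ∩ clusterInEvent ends s {W : Set V | o ∈ W} ∩
          (connEvent ends s t)ᶜ)) -
          2 * prob (Function.update p f 0) (clusterInEvent ends s 𝓤 ∩ clusterInEvent ends t {W : Set V | o ∈ W} ∩
          (connEvent ends s t)ᶜ) * prob (Function.update p f 0) (connEvent ends s t)ᶜ) * prob (Function.update p f 1) (connEvent ends s t)ᶜ +
        prob (Function.update p f 0) (clusterInEvent ends s 𝓤 ∩ (connEvent ends s t)ᶜ) * (prob (Function.update p f 0) (connEvent ends s t)ᶜ - prob (Function.update p f 0) (connEvent ends s u ∩ (connEvent ends s t)ᶜ)) * prob (Function.update p f 1) (clusterInEvent ends t {W : Set V | o ∈ W} ∩ (connEvent ends s t)ᶜ) -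
        prob (Function.update p f 0) (clusterInEvent ends s 𝓤 ∩ (connEvent ends s t)ᶜ) * (prob (Function.update p f 0) (clusterInEvent ends t {W : Set V | o ∈ W} ∩ (connEvent ends s t)ᶜ) + prob (Function.update p f 0) (clusterInEvent ends s {W : Set V | o ∈ W} ∩ (connEvent ends s t)ᶜ)) * prob (Function.update p f 1) (connEvent ends s u ∩ (connEvent ends s t)ᶜ) +
        prob (Function.update p f 0) (clusterInEvent ends s 𝓤 ∩ (connEvent ends s t)ᶜ) * prob (Function.update p f 0) (connEvent ends s t)ᶜ * (prob (Function.update p f 1) (connEvent ends s u ∩ clusterInEvent ends t {W : Set V | o ∈ W} ∩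
          (connEvent ends s t)ᶜ) + prob (Function.update p f 1) (connEvent ends s u ∩ clusterInEvent ends s {W : Set V | o ∈ W} ∩
          (connEvent ends s t)ᶜ)) -
        prob (Function.update p f 0) (clusterInEvent ends s 𝓤 ∩ (connEvent ends s t)ᶜ) * prob (Function.update p f 0) (connEvent ends s u ∩ (connEvent ends s t)ᶜ) * prob (Function.update p f 1) (clusterInEvent ends s {W : Set V | o ∈ W} ∩ (connEvent ends s t)ᶜ) -
        prob (Function.update p f 0) (connEvent ends s t)ᶜ * prob (Function.update p f 0) (connEvent ends s t)ᶜ * prob (Function.update p f 1) (clusterInEvent ends s 𝓤 ∩ clusterInEvent ends t {W : Set V | o ∈ W} ∩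
          (connEvent ends s t)ᶜ)) +
      (1 - p f) * p f ^ 2 * (((prob (Function.update p f 1) (connEvent ends s t)ᶜ - prob (Function.update p f 1) (connEvent ends s u ∩ (connEvent ends s t)ᶜ)) * prob (Function.update p f 1) (clusterInEvent ends t {W : Set V | o ∈ W} ∩ (connEvent ends s t)ᶜ) +
          prob (Function.update p f 1) (connEvent ends s t)ᶜ * (prob (Function.update p f 1) (connEvent ends s u ∩ clusterInEvent ends t {W : Set V | o ∈ W} ∩
          (connEvent ends s t)ᶜ) + prob (Function.update p f 1) (connEvent ends s u ∩ clusterInEvent ends s {W : Set V | o ∈ W} ∩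
          (connEvent ends s t)ᶜ)) -
          prob (Function.update p f 1) (connEvent ends s u ∩ (connEvent ends s t)ᶜ) * prob (Function.update p f 1) (clusterInEvent ends s {W : Set V | o ∈ W} ∩ (connEvent ends s t)ᶜ)) * prob (Function.update p f 0) (clusterInEvent ends s 𝓤 ∩ (connEvent ends s t)ᶜ) +
        (prob (Function.update p f 1) (clusterInEvent ends s 𝓤 ∩ (connEvent ends s t)ᶜ) * (prob (Function.update p f 1) (clusterInEvent ends t {W : Set V | o ∈ W} ∩ (connEvent ends s t)ᶜ) + prob (Function.update p f 1) (connEvent ends s u ∩ clusterInEvent ends t {W : Set V | o ∈ W} ∩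
          (connEvent ends s t)ᶜ) + prob (Function.update p f 1) (connEvent ends s u ∩ clusterInEvent ends s {W : Set V | o ∈ W} ∩
          (connEvent ends s t)ᶜ)) -
          2 * prob (Function.update p f 1) (clusterInEvent ends s 𝓤 ∩ clusterInEvent ends t {W : Set V | o ∈ W} ∩
          (connEvent ends s t)ᶜ) * prob (Function.update p f 1) (connEvent ends s t)ᶜ) * prob (Function.update p f 0) (connEvent ends s t)ᶜ +
        prob (Function.update p f 1) (clusterInEvent ends s 𝓤 ∩ (connEvent ends s t)ᶜ) * (prob (Function.update p f 1) (connEvent ends s t)ᶜ - prob (Function.update p f 1) (connEvent ends s u ∩ (connEvent ends s t)ᶜ)) * prob (Function.update p f 0) (clusterInEvent ends t {W : Set V | o ∈ W} ∩ (connEvent ends s t)ᶜ) -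
        prob (Function.update p f 1) (clusterInEvent ends s 𝓤 ∩ (connEvent ends s t)ᶜ) * (prob (Function.update p f 1) (clusterInEvent ends t {W : Set V | o ∈ W} ∩ (connEvent ends s t)ᶜ) + prob (Function.update p f 1) (clusterInEvent ends s {W : Set V | o ∈ W} ∩ (connEvent ends s t)ᶜ)) * prob (Function.update p f 0) (connEvent ends s u ∩ (connEvent ends s t)ᶜ) +
        prob (Function.update p f 1) (clusterInEvent ends s 𝓤 ∩ (connEvent ends s t)ᶜ) * prob (Function.update p f 1) (connEvent ends s t)ᶜ * (prob (Function.update p f 0) (connEvent ends s u ∩ clusterInEvent ends t {W : Set V | o ∈ W} ∩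
          (connEvent ends s t)ᶜ) + prob (Function.update p f 0) (connEvent ends s u ∩ clusterInEvent ends s {W : Set V | o ∈ W} ∩
          (connEvent ends s t)ᶜ)) -
        prob (Function.update p f 1) (clusterInEvent ends s 𝓤 ∩ (connEvent ends s t)ᶜ) * prob (Function.update p f 1) (connEvent ends s u ∩ (connEvent ends s t)ᶜ) * prob (Function.update p f 0) (clusterInEvent ends s {W : Set V | o ∈ W} ∩ (connEvent ends s t)ᶜ) -
        prob (Function.update p f 1) (connEvent ends s t)ᶜ * prob (Function.update p f 1) (connEvent ends s t)ᶜ * prob (Function.update p f 0) (clusterInEvent ends s 𝓤 ∩ clusterInEvent ends t {W : Set V | o ∈ W} ∩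
          (connEvent ends s t)ᶜ)) +
      p f ^ 3 * (prob (Function.update p f 1) (clusterInEvent ends s 𝓤 ∩ (connEvent ends s t)ᶜ) *
        ((prob (Function.update p f 1) (connEvent ends s t)ᶜ - prob (Function.update p f 1) (connEvent ends s u ∩ (connEvent ends s t)ᶜ)) *
            prob (Function.update p f 1) (clusterInEvent ends t {W : Set V | o ∈ W} ∩ (connEvent ends s t)ᶜ) +
          prob (Function.update p f 1) (connEvent ends s t)ᶜ *
            (prob (Function.update p f 1) (connEvent ends s u ∩ clusterInEvent ends t {W : Set V | o ∈ W} ∩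
          (connEvent ends s t)ᶜ) +
              prob (Function.update p f 1) (connEvent ends s u ∩ clusterInEvent ends s {W : Set V | o ∈ W} ∩
          (connEvent ends s t)ᶜ)) -
          prob (Function.update p f 1) (connEvent ends s u ∩ (connEvent ends s t)ᶜ) *
            prob (Function.update p f 1) (clusterInEvent ends s {W : Set V | o ∈ W} ∩ (connEvent ends s t)ᶜ)) -
      prob (Function.update p f 1) (clusterInEvent ends s 𝓤 ∩ clusterInEvent ends t {W : Set V | o ∈ W} ∩
          (connEvent ends s t)ᶜ) * prob (Function.update p f 1) (connEvent ends s t)ᶜ * prob (Function.update p f 1) (connEvent ends s t)ᶜ) := by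
  have e1 := prob_eq_pin p (connEvent ends s t)ᶜ f
  have e2 := prob_eq_pin p (clusterInEvent ends t {W : Set V | o ∈ W} ∩ (connEvent ends s t)ᶜ) f
  have e3 := prob_eq_pin p (clusterInEvent ends s {W : Set V | o ∈ W} ∩ (connEvent ends s t)ᶜ) f
  have e4 := prob_eq_pin p (connEvent ends s u ∩ (connEvent ends s t)ᶜ) f
  have e5 := prob_eq_pin p (connEvent ends s u ∩ clusterInEvent ends t {W : Set V | o ∈ W} ∩
    (connEvent ends s t)ᶜ) f
  have e6 := prob_eq_pin p (connEvent ends s u ∩ clusterInEvent ends s {W : Set V | o ∈ W} ∩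
    (connEvent ends s t)ᶜ) f
  have e7 := prob_eq_pin p (clusterInEvent ends s 𝓤 ∩ (connEvent ends s t)ᶜ) f
  have e8 := prob_eq_pin p (clusterInEvent ends s 𝓤 ∩ clusterInEvent ends t {W : Set V | o ∈ W} ∩
    (connEvent ends s t)ᶜ) f
  rw [e1, e2, e3, e4, e5, e6, e7, e8]
  exact bernstein_algebra _ _ _ _ _ _ _ _ _ _ _ _ _ _ _ _ _

/-- The pin induction with the weakest step hypothesis: if every admissible `p` with an unpinned
edge has SOME unpinned edge `f` along which `0 ≤ Σ(p[f↦0])` and `0 ≤ Σ(p[f↦1])` imply `0 ≤ Σ(p)`,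
then `0 ≤ Σ(p)` for every admissible `p`. -/
theorem psi_slack_nonneg_of_step (ends : E → Sym2 V) (s t o u : V) (𝓤 : Set (Set V))
    (hstep : ∀ p : E → R, IsProbVec p → (∃ e, p e ≠ 0 ∧ p e ≠ 1) →
      ∃ f, p f ≠ 0 ∧ p f ≠ 1 ∧
        (0 ≤ (prob (Function.update p f 0) (clusterInEvent ends s 𝓤 ∩ (connEvent ends s t)ᶜ) *
        ((prob (Function.update p f 0) (connEvent ends s t)ᶜ - prob (Function.update p f 0) (connEvent ends s u ∩ (connEvent ends s t)ᶜ)) *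
            prob (Function.update p f 0) (clusterInEvent ends t {W : Set V | o ∈ W} ∩ (connEvent ends s t)ᶜ) +
          prob (Function.update p f 0) (connEvent ends s t)ᶜ *
            (prob (Function.update p f 0) (connEvent ends s u ∩ clusterInEvent ends t {W : Set V | o ∈ W} ∩
          (connEvent ends s t)ᶜ) +
              prob (Function.update p f 0) (connEvent ends s u ∩ clusterInEvent ends s {W : Set V | o ∈ W} ∩
          (connEvent ends s t)ᶜ)) -
          prob (Function.update p f 0) (connEvent ends s u ∩ (connEvent ends s t)ᶜ) *
            prob (Function.update p f 0) (clusterInEvent ends s {W : Set V | o ∈ W} ∩ (connEvent ends s t)ᶜ)) -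
      prob (Function.update p f 0) (clusterInEvent ends s 𝓤 ∩ clusterInEvent ends t {W : Set V | o ∈ W} ∩
          (connEvent ends s t)ᶜ) * prob (Function.update p f 0) (connEvent ends s t)ᶜ * prob (Function.update p f 0) (connEvent ends s t)ᶜ) →
        0 ≤ (prob (Function.update p f 1) (clusterInEvent ends s 𝓤 ∩ (connEvent ends s t)ᶜ) *
        ((prob (Function.update p f 1) (connEvent ends s t)ᶜ - prob (Function.update p f 1) (connEvent ends s u ∩ (connEvent ends s t)ᶜ)) *
            prob (Function.update p f 1) (clusterInEvent ends t {W : Set V | o ∈ W} ∩ (connEvent ends s t)ᶜ) +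
          prob (Function.update p f 1) (connEvent ends s t)ᶜ *
            (prob (Function.update p f 1) (connEvent ends s u ∩ clusterInEvent ends t {W : Set V | o ∈ W} ∩
          (connEvent ends s t)ᶜ) +
              prob (Function.update p f 1) (connEvent ends s u ∩ clusterInEvent ends s {W : Set V | o ∈ W} ∩
          (connEvent ends s t)ᶜ)) -
          prob (Function.update p f 1) (connEvent ends s u ∩ (connEvent ends s t)ᶜ) *
            prob (Function.update p f 1) (clusterInEvent ends s {W : Set V | o ∈ W} ∩ (connEvent ends s t)ᶜ)) -
      prob (Function.update p f 1) (clusterInEvent ends s 𝓤 ∩ clusterInEvent ends t {W : Set V | o ∈ W} ∩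
          (connEvent ends s t)ᶜ) * prob (Function.update p f 1) (connEvent ends s t)ᶜ * prob (Function.update p f 1) (connEvent ends s t)ᶜ) →
        0 ≤ (prob p (clusterInEvent ends s 𝓤 ∩ (connEvent ends s t)ᶜ) *
        ((prob p (connEvent ends s t)ᶜ - prob p (connEvent ends s u ∩ (connEvent ends s t)ᶜ)) *
            prob p (clusterInEvent ends t {W : Set V | o ∈ W} ∩ (connEvent ends s t)ᶜ) +
          prob p (connEvent ends s t)ᶜ *
            (prob p (connEvent ends s u ∩ clusterInEvent ends t {W : Set V | o ∈ W} ∩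
          (connEvent ends s t)ᶜ) +
              prob p (connEvent ends s u ∩ clusterInEvent ends s {W : Set V | o ∈ W} ∩
          (connEvent ends s t)ᶜ)) -
          prob p (connEvent ends s u ∩ (connEvent ends s t)ᶜ) *
            prob p (clusterInEvent ends s {W : Set V | o ∈ W} ∩ (connEvent ends s t)ᶜ)) -
      prob p (clusterInEvent ends s 𝓤 ∩ clusterInEvent ends t {W : Set V | o ∈ W} ∩
          (connEvent ends s t)ᶜ) * prob p (connEvent ends s t)ᶜ * prob p (connEvent ends s t)ᶜ))) :
    ∀ p : E → R, IsProbVec p → 0 ≤ (prob p (clusterInEvent ends s 𝓤 ∩ (connEvent ends s t)ᶜ) *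
        ((prob p (connEvent ends s t)ᶜ - prob p (connEvent ends s u ∩ (connEvent ends s t)ᶜ)) *
            prob p (clusterInEvent ends t {W : Set V | o ∈ W} ∩ (connEvent ends s t)ᶜ) +
          prob p (connEvent ends s t)ᶜ *
            (prob p (connEvent ends s u ∩ clusterInEvent ends t {W : Set V | o ∈ W} ∩
          (connEvent ends s t)ᶜ) +
              prob p (connEvent ends s u ∩ clusterInEvent ends s {W : Set V | o ∈ W} ∩
          (connEvent ends s t)ᶜ)) -
          prob p (connEvent ends s u ∩ (connEvent ends s t)ᶜ) *
            prob p (clusterInEvent ends s {W : Set V | o ∈ W} ∩ (connEvent ends s t)ᶜ)) -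
      prob p (clusterInEvent ends s 𝓤 ∩ clusterInEvent ends t {W : Set V | o ∈ W} ∩
          (connEvent ends s t)ᶜ) * prob p (connEvent ends s t)ᶜ * prob p (connEvent ends s t)ᶜ) := by
  suffices key : ∀ n : ℕ, ∀ p : E → R, IsProbVec p →
      (Finset.univ.filter fun e => p e ≠ 0 ∧ p e ≠ 1).card = n → 0 ≤ (prob p (clusterInEvent ends s 𝓤 ∩ (connEvent ends s t)ᶜ) *
        ((prob p (connEvent ends s t)ᶜ - prob p (connEvent ends s u ∩ (connEvent ends s t)ᶜ)) *
            prob p (clusterInEvent ends t {W : Set V | o ∈ W} ∩ (connEvent ends s t)ᶜ) +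
          prob p (connEvent ends s t)ᶜ *
            (prob p (connEvent ends s u ∩ clusterInEvent ends t {W : Set V | o ∈ W} ∩
          (connEvent ends s t)ᶜ) +
              prob p (connEvent ends s u ∩ clusterInEvent ends s {W : Set V | o ∈ W} ∩
          (connEvent ends s t)ᶜ)) -
          prob p (connEvent ends s u ∩ (connEvent ends s t)ᶜ) *
            prob p (clusterInEvent ends s {W : Set V | o ∈ W} ∩ (connEvent ends s t)ᶜ)) -
      prob p (clusterInEvent ends s 𝓤 ∩ clusterInEvent ends t {W : Set V | o ∈ W} ∩
          (connEvent ends s t)ᶜ) * prob p (connEvent ends s t)ᶜ * prob p (connEvent ends s t)ᶜ) by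
    intro p hp
    exact key _ p hp rfl
  intro n
  induction n with
  | zero =>
    intro p hp hcard
    have h01 : ∀ e, p e = 0 ∨ p e = 1 := by
      intro e
      by_contra hne
      have hne' : p e ≠ 0 ∧ p e ≠ 1 := ⟨fun h => hne (Or.inl h), fun h => hne (Or.inr h)⟩
      have : e ∈ (Finset.univ.filter fun e => p e ≠ 0 ∧ p e ≠ 1) := by
        simp [hne'.1, hne'.2]
      rw [Finset.card_eq_zero.1 hcard] at this
      exact absurd this (Finset.notMem_empty e)
    rw [psiPin_slack_eq_zero p h01 ends s t o u 𝓤]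
  | succ n ih =>
    intro p hp hcard
    have hex : ∃ e, p e ≠ 0 ∧ p e ≠ 1 := by
      have hpos : 0 < (Finset.univ.filter fun e => p e ≠ 0 ∧ p e ≠ 1).card := by
        rw [hcard]; exact Nat.succ_pos n
      obtain ⟨e, he⟩ := Finset.card_pos.1 hpos
      simp only [Finset.mem_filter, Finset.mem_univ, true_and] at he
      exact ⟨e, he⟩
    obtain ⟨f, hf0, hf1, hstepf⟩ := hstep p hp hex
    have hmem : f ∈ (Finset.univ.filter fun e => p e ≠ 0 ∧ p e ≠ 1) := by simp [hf0, hf1]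
    have hcard' : ∀ c : R, c = 0 ∨ c = 1 →
        (Finset.univ.filter fun e => Function.update p f c e ≠ 0 ∧
          Function.update p f c e ≠ 1).card = n := by
      intro c hc
      rw [psiPin_filter_unpinned_update p f c hc, Finset.card_erase_of_mem hmem, hcard]
      rfl
    have h0 := ih (Function.update p f 0) (hp.update f le_rfl zero_le_one) (hcard' 0 (Or.inl rfl))
    have h1 := ih (Function.update p f 1) (hp.update f zero_le_one le_rfl) (hcard' 1 (Or.inr rfl))
    exact hstepf h0 h1

/-- **The frame (Ψ) ⟸ (BERN).** If every admissible `p` with an unpinned edge has SOME unpinned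
edge `f` whose two mixed Bernstein coefficients `T₁ = ∇Σ(M⁰)·M¹` and `T₂ = ∇Σ(M¹)·M⁰` are
nonnegative, then `0 ≤ Σ_𝓤(p)` — the (Ψ) inequality on `𝓤` — for every admissible `p`. -/
theorem psi_slack_nonneg_of_bern (ends : E → Sym2 V) (s t o u : V) (𝓤 : Set (Set V))
    (hbern : ∀ p : E → R, IsProbVec p → (∃ e, p e ≠ 0 ∧ p e ≠ 1) →
      ∃ f, p f ≠ 0 ∧ p f ≠ 1 ∧
        0 ≤ (((prob (Function.update p f 0) (connEvent ends s t)ᶜ - prob (Function.update p f 0) (connEvent ends s u ∩ (connEvent ends s t)ᶜ)) * prob (Function.update p f 0) (clusterInEvent ends t {W : Set V | o ∈ W} ∩ (connEvent ends s t)ᶜ) +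
          prob (Function.update p f 0) (connEvent ends s t)ᶜ * (prob (Function.update p f 0) (connEvent ends s u ∩ clusterInEvent ends t {W : Set V | o ∈ W} ∩
          (connEvent ends s t)ᶜ) + prob (Function.update p f 0) (connEvent ends s u ∩ clusterInEvent ends s {W : Set V | o ∈ W} ∩
          (connEvent ends s t)ᶜ)) -
          prob (Function.update p f 0) (connEvent ends s u ∩ (connEvent ends s t)ᶜ) * prob (Function.update p f 0) (clusterInEvent ends s {W : Set V | o ∈ W} ∩ (connEvent ends s t)ᶜ)) * prob (Function.update p f 1) (clusterInEvent ends s 𝓤 ∩ (connEvent ends s t)ᶜ) +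
        (prob (Function.update p f 0) (clusterInEvent ends s 𝓤 ∩ (connEvent ends s t)ᶜ) * (prob (Function.update p f 0) (clusterInEvent ends t {W : Set V | o ∈ W} ∩ (connEvent ends s t)ᶜ) + prob (Function.update p f 0) (connEvent ends s u ∩ clusterInEvent ends t {W : Set V | o ∈ W} ∩
          (connEvent ends s t)ᶜ) + prob (Function.update p f 0) (connEvent ends s u ∩ clusterInEvent ends s {W : Set V | o ∈ W} ∩
          (connEvent ends s t)ᶜ)) -
          2 * prob (Function.update p f 0) (clusterInEvent ends s 𝓤 ∩ clusterInEvent ends t {W : Set V | o ∈ W} ∩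
          (connEvent ends s t)ᶜ) * prob (Function.update p f 0) (connEvent ends s t)ᶜ) * prob (Function.update p f 1) (connEvent ends s t)ᶜ +
        prob (Function.update p f 0) (clusterInEvent ends s 𝓤 ∩ (connEvent ends s t)ᶜ) * (prob (Function.update p f 0) (connEvent ends s t)ᶜ - prob (Function.update p f 0) (connEvent ends s u ∩ (connEvent ends s t)ᶜ)) * prob (Function.update p f 1) (clusterInEvent ends t {W : Set V | o ∈ W} ∩ (connEvent ends s t)ᶜ) -
        prob (Function.update p f 0) (clusterInEvent ends s 𝓤 ∩ (connEvent ends s t)ᶜ) * (prob (Function.update p f 0) (clusterInEvent ends t {W : Set V | o ∈ W} ∩ (connEvent ends s t)ᶜ) + prob (Function.update p f 0) (clusterInEvent ends s {W : Set V | o ∈ W} ∩ (connEvent ends s t)ᶜ)) * prob (Function.update p f 1) (connEvent ends s u ∩ (connEvent ends s t)ᶜ) +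
        prob (Function.update p f 0) (clusterInEvent ends s 𝓤 ∩ (connEvent ends s t)ᶜ) * prob (Function.update p f 0) (connEvent ends s t)ᶜ * (prob (Function.update p f 1) (connEvent ends s u ∩ clusterInEvent ends t {W : Set V | o ∈ W} ∩
          (connEvent ends s t)ᶜ) + prob (Function.update p f 1) (connEvent ends s u ∩ clusterInEvent ends s {W : Set V | o ∈ W} ∩
          (connEvent ends s t)ᶜ)) -
        prob (Function.update p f 0) (clusterInEvent ends s 𝓤 ∩ (connEvent ends s t)ᶜ) * prob (Function.update p f 0) (connEvent ends s u ∩ (connEvent ends s t)ᶜ) * prob (Function.update p f 1) (clusterInEvent ends s {W : Set V | o ∈ W} ∩ (connEvent ends s t)ᶜ) -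
        prob (Function.update p f 0) (connEvent ends s t)ᶜ * prob (Function.update p f 0) (connEvent ends s t)ᶜ * prob (Function.update p f 1) (clusterInEvent ends s 𝓤 ∩ clusterInEvent ends t {W : Set V | o ∈ W} ∩
          (connEvent ends s t)ᶜ)) ∧
        0 ≤ (((prob (Function.update p f 1) (connEvent ends s t)ᶜ - prob (Function.update p f 1) (connEvent ends s u ∩ (connEvent ends s t)ᶜ)) * prob (Function.update p f 1) (clusterInEvent ends t {W : Set V | o ∈ W} ∩ (connEvent ends s t)ᶜ) +
          prob (Function.update p f 1) (connEvent ends s t)ᶜ * (prob (Function.update p f 1) (connEvent ends s u ∩ clusterInEvent ends t {W : Set V | o ∈ W} ∩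
          (connEvent ends s t)ᶜ) + prob (Function.update p f 1) (connEvent ends s u ∩ clusterInEvent ends s {W : Set V | o ∈ W} ∩
          (connEvent ends s t)ᶜ)) -
          prob (Function.update p f 1) (connEvent ends s u ∩ (connEvent ends s t)ᶜ) * prob (Function.update p f 1) (clusterInEvent ends s {W : Set V | o ∈ W} ∩ (connEvent ends s t)ᶜ)) * prob (Function.update p f 0) (clusterInEvent ends s 𝓤 ∩ (connEvent ends s t)ᶜ) +
        (prob (Function.update p f 1) (clusterInEvent ends s 𝓤 ∩ (connEvent ends s t)ᶜ) * (prob (Function.update p f 1) (clusterInEvent ends t {W : Set V | o ∈ W} ∩ (connEvent ends s t)ᶜ) + prob (Function.update p f 1) (connEvent ends s u ∩ clusterInEvent ends t {W : Set V | o ∈ W} ∩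
          (connEvent ends s t)ᶜ) + prob (Function.update p f 1) (connEvent ends s u ∩ clusterInEvent ends s {W : Set V | o ∈ W} ∩
          (connEvent ends s t)ᶜ)) -
          2 * prob (Function.update p f 1) (clusterInEvent ends s 𝓤 ∩ clusterInEvent ends t {W : Set V | o ∈ W} ∩
          (connEvent ends s t)ᶜ) * prob (Function.update p f 1) (connEvent ends s t)ᶜ) * prob (Function.update p f 0) (connEvent ends s t)ᶜ +
        prob (Function.update p f 1) (clusterInEvent ends s 𝓤 ∩ (connEvent ends s t)ᶜ) * (prob (Function.update p f 1) (connEvent ends s t)ᶜ - prob (Function.update p f 1) (connEvent ends s u ∩ (connEvent ends s t)ᶜ)) * prob (Function.update p f 0) (clusterInEvent ends t {W : Set V | o ∈ W} ∩ (connEvent ends s t)ᶜ) -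
        prob (Function.update p f 1) (clusterInEvent ends s 𝓤 ∩ (connEvent ends s t)ᶜ) * (prob (Function.update p f 1) (clusterInEvent ends t {W : Set V | o ∈ W} ∩ (connEvent ends s t)ᶜ) + prob (Function.update p f 1) (clusterInEvent ends s {W : Set V | o ∈ W} ∩ (connEvent ends s t)ᶜ)) * prob (Function.update p f 0) (connEvent ends s u ∩ (connEvent ends s t)ᶜ) +
        prob (Function.update p f 1) (clusterInEvent ends s 𝓤 ∩ (connEvent ends s t)ᶜ) * prob (Function.update p f 1) (connEvent ends s t)ᶜ * (prob (Function.update p f 0) (connEvent ends s u ∩ clusterInEvent ends t {W : Set V | o ∈ W} ∩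
          (connEvent ends s t)ᶜ) + prob (Function.update p f 0) (connEvent ends s u ∩ clusterInEvent ends s {W : Set V | o ∈ W} ∩
          (connEvent ends s t)ᶜ)) -
        prob (Function.update p f 1) (clusterInEvent ends s 𝓤 ∩ (connEvent ends s t)ᶜ) * prob (Function.update p f 1) (connEvent ends s u ∩ (connEvent ends s t)ᶜ) * prob (Function.update p f 0) (clusterInEvent ends s {W : Set V | o ∈ W} ∩ (connEvent ends s t)ᶜ) -
        prob (Function.update p f 1) (connEvent ends s t)ᶜ * prob (Function.update p f 1) (connEvent ends s t)ᶜ * prob (Function.update p f 0) (clusterInEvent ends s 𝓤 ∩ clusterInEvent ends t {W : Set V | o ∈ W} ∩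
          (connEvent ends s t)ᶜ))) :
    ∀ p : E → R, IsProbVec p → 0 ≤ (prob p (clusterInEvent ends s 𝓤 ∩ (connEvent ends s t)ᶜ) *
        ((prob p (connEvent ends s t)ᶜ - prob p (connEvent ends s u ∩ (connEvent ends s t)ᶜ)) *
            prob p (clusterInEvent ends t {W : Set V | o ∈ W} ∩ (connEvent ends s t)ᶜ) +
          prob p (connEvent ends s t)ᶜ *
            (prob p (connEvent ends s u ∩ clusterInEvent ends t {W : Set V | o ∈ W} ∩
          (connEvent ends s t)ᶜ) +
              prob p (connEvent ends s u ∩ clusterInEvent ends s {W : Set V | o ∈ W} ∩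
          (connEvent ends s t)ᶜ)) -
          prob p (connEvent ends s u ∩ (connEvent ends s t)ᶜ) *
            prob p (clusterInEvent ends s {W : Set V | o ∈ W} ∩ (connEvent ends s t)ᶜ)) -
      prob p (clusterInEvent ends s 𝓤 ∩ clusterInEvent ends t {W : Set V | o ∈ W} ∩
          (connEvent ends s t)ᶜ) * prob p (connEvent ends s t)ᶜ * prob p (connEvent ends s t)ᶜ) := by
  refine psi_slack_nonneg_of_step ends s t o u 𝓤 fun p hp hex => ?_
  obtain ⟨f, hf0, hf1, hT1, hT2⟩ := hbern p hp hex
  refine ⟨f, hf0, hf1, fun h0 h1 => ?_⟩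
  rw [psi_slack_eq_bernstein p ends s t o u 𝓤 f]
  exact bern_step_algebra (hp.nonneg f) (hp.le_one f) h0 h1 hT1 hT2

end Bernstein

end Summit.Ventures.PercRepro2
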